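import Summits.HubbardSuperconductivity.HubbardSuperconductivity.Theorems.LevyLogBootstrapBlock2InfDivXXZLevyEquivalence
import HarnessLib

/-!
# Crux `Block2InfDivXXZ` (stmt-HubbardSuperconductivity-15048; route `LevyLogBootstrap`, rank 2) —
# SKELETON v2 of line `birth`: ONE open stub, `levyCoeff_nonneg`

Reshape of `Cruxes/Block2InfDivXXZ/Lines/birth.lean` after the landings of 2026-08-17:

* stub 1 `stub_transverseKernelPos` (Perron–Frobenius positivity) — LANDED
  (`Theorems/LevyLogBootstrapBlock2InfDivXXZStubTransverseKernelPos.lean`, p151328);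
* translation covariance of the sector ground-state kernel — LANDED (`…KernelCovariance.lean`, p156073);
* finite-abelian / torus Bochner in negative-type form — LANDED (`…FiniteBochner.lean` p156129,
  `Literature/Probability/LatticeModels/TorusNegTypeBochner.lean` p155789);
* block map, factorisation `K₂(x,y) = k₂(βx − βy)`, evenness, and
  `stub_blockLogNegType_of_levyCoeff` / `Block2InfDivXXZ_of_levyCoeff_nonneg` — LANDED
  (`…LevyReduction.lean`, p157025);
* the converse and `Block2InfDivXXZ_iff_levyCoeff_nonneg : crux ↔ (∀ ν_q ≥ 0)` — LANDED
  (`…LevyEquivalence.lean`, p157318).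

Hence the old load-bearing stub `stub_blockLogNegType` (`-log K₂` of negative type) is now DERIVED from
the single remaining stub `levyCoeff_nonneg` (registered on the item 2026-08-17): for every even `M ≥ 4`,
`Δ ∈ [-1,0]`, normalised `S^z_tot = 0` sector ground state `ψ` and every nonzero coarse momentum
`q ∈ (ℤ/(M/2))²`, the Lévy coefficient `ν_q = Σ_X log k₂(X) · Re χ_q(X)` is nonnegative, where
`k₂(X) = Σ_{β x' = X, β y' = 0} Re⟨ψ, S⁺_{x'} S⁻_{y'} ψ⟩` is the coarse 2×2-block kernel. By the landed
equivalence this stub IS the crux (kernel-checked both ways); numerically `N_c · min_q ν_q ≈ 0.20–0.27 > 0`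
for all tested `M ≤ 32`, `Δ ∈ [-1,0]` (item evidence EVIDENCE-Block2InfDivXXZ.md, EVIDENCE-falsifiers-r1.md).

Composition `Block2InfDivXXZ_of : …Theses.LevyLogBootstrap.Block2InfDivXXZ` concludes the crux BY NAME from
the one stub via the landed `Block2InfDivXXZ_of_levyCoeff_nonneg`; no `sorry` outside the stub.
-/

noncomputable section

-- `dupNamespace`: the summit and the problem are both named `HubbardSuperconductivity` (layout D-0022)
set_option linter.dupNamespace false

namespace Summit.HubbardSuperconductivity.HubbardSuperconductivity.Cruxes.Block2InfDivXXZ.Birth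

open Matrix Finset
open Literature.Probability.LatticeModels Literature.MathematicalPhysics.QuantumLattice
open Literature.Analysis.Matrix
open Summit.HubbardSuperconductivity.HubbardSuperconductivity.Theorems.LevyLogBootstrap
open scoped ComplexOrder Matrix BigOperators

/-! ## The one open stub -/

/-- **STUB `levyCoeff_nonneg` — ALL LÉVY COEFFICIENTS OF THE COARSE 2×2-BLOCK KERNEL ARE
NONNEGATIVE** (the crux's entire content, by `Block2InfDivXXZ_iff_levyCoeff_nonneg`). For every even
`M ≥ 4`, `Δ ∈ [-1, 0]`, every normalised `S^z_tot = 0` sector ground state `ψ` of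
`H_M(Δ) = xxzHamiltonian 1 (torusGraph 2 M) (-1) Δ` and every `q ≠ 0` in `(ℤ/(M/2))²`:
`0 ≤ Σ_X log k₂(X) · Re χ_q(X)`, `k₂(X) = Σ_{⌊x'/2⌋ = X, ⌊y'/2⌋ = 0} Re⟨ψ, S⁺_{x'} S⁻_{y'} ψ⟩`.
Open conjecture (grounder: no print counterpart); ED/QMC: true with margin `N_c·ν_min ≈ 0.20–0.27`
on all tested `(M ≤ 32, Δ)`. -/
theorem levyCoeff_nonneg :
    ∀ (M : ℕ) [NeZero M] [NeZero (M / 2)], Even M → 4 ≤ M → ∀ Δ ∈ Set.Icc (-1:ℝ) 0,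
      ∀ (ψ : TensorIndex (TorusSite 2 M) 2 → ℂ),
      ψ ∈ @spinZSector (TorusSite 2 M) _ _ 1 0 → star ψ ⬝ᵥ ψ = 1 →
      Matrix.mulVec (xxzHamiltonian 1 (torusGraph 2 M) (-1) Δ) ψ =
        ((lowestEnergyInSector 1 (xxzHamiltonian 1 (torusGraph 2 M) (-1) Δ) 0 : ℝ) : ℂ) • ψ →
      ∀ q : TorusSite 2 (M / 2), q ≠ 0 →
        0 ≤ ∑ X : TorusSite 2 (M / 2), Real.log (∑ x' : TorusSite 2 M, ∑ y' : TorusSite 2 M,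
              if (∀ i : Fin 2, (x' i).val / 2 = (X i).val) ∧ (∀ i : Fin 2, (y' i).val / 2 = 0) then
                (star ψ ⬝ᵥ Matrix.mulVec
                  (onSite x' (spinRaise 1) * onSite y' (spinLower 1)) ψ).re
              else 0) * (torusChar q X).re := by
  sorry

/-! ## The composition: the stub implies the crux, by name -/

/-- **`Block2InfDivXXZ_of`** — `levyCoeff_nonneg → LevyLogBootstrap.Block2InfDivXXZ` through the
landed reduction `Block2InfDivXXZ_of_levyCoeff_nonneg` (block positivity by Perron–Frobenius, Bochner
on the coarse torus, Schoenberg's theorem for Hadamard powers). Concludes the crux BY NAME; its only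
`sorryAx` dependence is the stub. [cite: BergChristensenRessel1984, Ch. 3 Thm. 2.2, Ch. 4 §3] -/
theorem Block2InfDivXXZ_of :
    Summit.HubbardSuperconductivity.HubbardSuperconductivity.Theses.LevyLogBootstrap.Block2InfDivXXZ :=
  Block2InfDivXXZ_of_levyCoeff_nonneg
    (fun M _ _ hEven h4 Δ hΔ ψ hψ hnorm heig q hq =>
      levyCoeff_nonneg M hEven h4 Δ hΔ ψ hψ hnorm heig q hq)

end Summit.HubbardSuperconductivity.HubbardSuperconductivity.Cruxes.Block2InfDivXXZ.Birth

end
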